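import Mathlib

/-!
# Window canoniser, I: labels `(U, X, λ)` and their symmetry (definitions)

Route `PneNP/SymmetryBudget`, dichotomy `WindowBarrier` (stmt-PneNP-2145) / `NoHiddenOrder` (stmt-PneNP-14781).
This is the first file of the construction of a `Bud(m, n)`-symmetric `tcBasis` circuit canonising the
`n = ⌊log₂ m⌋`-vertex WINDOW of an `m × m` adjacency matrix (the certified-label scheme of the memos
ANALYSIS-4 / PROOF-NoHiddenOrder over the Corneil–Goldberg process `Literature.…CGCanon`), which proves
`NoHiddenOrder` and refutes `WindowBarrier` through `noHiddenOrder_of_entrywiseCanoniser`.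

A gate group of the circuit is indexed by a LABEL `(U, X, λ)`: `U` the vertex set of the intended state of
the process, `X` the vertices individualised on the way to it, `λ : X → {0,…,n}` their recorded heights
(extended by `0`).  Only labels whose heights have SMALL TOTAL BIT-LENGTH are admitted (`WCan.RawLab.admSet K n`:
`∑_{v ∈ X} ⌊log₂ (λ v + 1)⌋ ≤ K n`), which makes the label set — hence the circuit — of size `2^{O(n)}`
(`…LabelCount.lean`).  Here: `RawLab`, `admSet`, the admissible labels `Lab K n`, the action of `Sym(Fin n)`
(relabelling the window), the syntactic measure `M(L) = |U|(n+1) + (n - |X|)` and the two label formers a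
group reads — `cand` (one more individualised vertex) and `part` (a smaller vertex set) — which strictly
decrease it.  Mathlib only.
-/

-- `Summit.PneNP.PneNP.…` duplicates `PneNP` BY DESIGN (single-problem summit, D-0017 layout).
set_option linter.dupNamespace false

namespace Summit.PneNP.PneNP.Theorems

namespace WCan

open Finset Equiv

/-- A raw label `(U, X, λ)` on the window `Fin n`: intended vertex set, individualised vertices, heights
(values in `Fin (n+1)`, `0` off `X` for admissible labels). -/
structure RawLab (n : ℕ) where
  /-- vertex set of the intended state -/
  U : Finset (Fin n)
  /-- individualised vertices -/
  X : Finset (Fin n)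
  /-- recorded heights -/
  lam : Fin n → Fin (n + 1)
  deriving DecidableEq, Fintype

namespace RawLab

variable {n : ℕ}

/-- The ADMISSIBLE labels at constant `K`, as a finset: heights vanish off `X` and have total bit-length at most
`K n` (`∑_{v ∈ X} ⌊log₂ (λ v + 1)⌋ ≤ K n`).  Along a root–node path of the process the recorded height of a vertex
is less than the size of the cell it was taken from, and the sizes of those cells have total logarithm `O(n)`
(Corneil–Goldberg), so the labels of a solution subtree are admissible; and there are only `2^{O(n)}`
admissible labels (`…LabelCount.lean`). -/
def admSet (K n : ℕ) : Finset (RawLab n) :=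
  univ.filter fun L => (∀ v, v ∉ L.X → L.lam v = 0) ∧ ∑ v ∈ L.X, Nat.log 2 ((L.lam v : ℕ) + 1) ≤ K * n

/-- Membership in `admSet`. -/
theorem mem_admSet {K : ℕ} {L : RawLab n} : L ∈ admSet K n ↔
    (∀ v, v ∉ L.X → L.lam v = 0) ∧ ∑ v ∈ L.X, Nat.log 2 ((L.lam v : ℕ) + 1) ≤ K * n := by
  simp [admSet]

/-! ### The action of window permutations -/

/-- Relabelling the window by `π`: `(U, X, λ) ↦ (π U, π X, λ ∘ π⁻¹)`. -/
def act (π : Perm (Fin n)) (L : RawLab n) : RawLab n :=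
  ⟨L.U.map π.toEmbedding, L.X.map π.toEmbedding, L.lam ∘ π.symm⟩

/-- `act_U`: bookkeeping/simp lemma (act U). -/
@[simp] theorem act_U (π : Perm (Fin n)) (L : RawLab n) : (L.act π).U = L.U.map π.toEmbedding := rfl
/-- `act_X`: bookkeeping/simp lemma (act X). -/
@[simp] theorem act_X (π : Perm (Fin n)) (L : RawLab n) : (L.act π).X = L.X.map π.toEmbedding := rfl
/-- `act_lam`: bookkeeping/simp lemma (act lam). -/
@[simp] theorem act_lam (π : Perm (Fin n)) (L : RawLab n) (v : Fin n) : (L.act π).lam v = L.lam (π.symm v) := rfl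

/-- Membership in the relabelled vertex set. -/
theorem mem_act_U {π : Perm (Fin n)} {L : RawLab n} {v : Fin n} : v ∈ (L.act π).U ↔ π.symm v ∈ L.U := by
  rw [act_U, mem_map_equiv]

/-- Membership in the relabelled individualised set. -/
theorem mem_act_X {π : Perm (Fin n)} {L : RawLab n} {v : Fin n} : v ∈ (L.act π).X ↔ π.symm v ∈ L.X := by
  rw [act_X, mem_map_equiv]

/-- `π v` lies in `π U` iff `v ∈ U`. -/
theorem apply_mem_act_U {π : Perm (Fin n)} {L : RawLab n} {v : Fin n} : π v ∈ (L.act π).U ↔ v ∈ L.U := by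
  rw [mem_act_U, symm_apply_apply]

/-- `π v` lies in `π X` iff `v ∈ X`. -/
theorem apply_mem_act_X {π : Perm (Fin n)} {L : RawLab n} {v : Fin n} : π v ∈ (L.act π).X ↔ v ∈ L.X := by
  rw [mem_act_X, symm_apply_apply]

/-- Heights of relabelled vertices. -/
@[simp] theorem act_lam_apply (π : Perm (Fin n)) (L : RawLab n) (v : Fin n) : (L.act π).lam (π v) = L.lam v := by
  rw [act_lam, symm_apply_apply]

/-- The identity acts trivially. -/
@[simp] theorem act_one (L : RawLab n) : L.act 1 = L := by
  cases L; simp [act, Finset.map_eq_image]; rfl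

/-- The action is multiplicative. -/
theorem act_mul (π τ : Perm (Fin n)) (L : RawLab n) : L.act (π * τ) = (L.act τ).act π := by
  cases L with
  | mk U X lam =>
    simp only [act, mk.injEq, Finset.map_map]
    refine ⟨?_, ?_, ?_⟩
    · rfl
    · rfl
    · funext v; simp [Perm.mul_def]

/-- `act π⁻¹` inverts `act π`. -/
@[simp] theorem act_inv_act (π : Perm (Fin n)) (L : RawLab n) : (L.act π).act π⁻¹ = L := by
  rw [← act_mul, inv_mul_cancel, act_one]

/-- `act π` inverts `act π⁻¹`. -/
@[simp] theorem act_act_inv (π : Perm (Fin n)) (L : RawLab n) : (L.act π⁻¹).act π = L := by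
  rw [← act_mul, mul_inv_cancel, act_one]

/-- Cardinality of the relabelled vertex set. -/
@[simp] theorem card_act_U (π : Perm (Fin n)) (L : RawLab n) : (L.act π).U.card = L.U.card := card_map _

/-- Cardinality of the relabelled individualised set. -/
@[simp] theorem card_act_X (π : Perm (Fin n)) (L : RawLab n) : (L.act π).X.card = L.X.card := card_map _

/-- **Admissibility is invariant under relabelling.** -/
theorem act_mem_admSet_iff {K : ℕ} {π : Perm (Fin n)} {L : RawLab n} : L.act π ∈ admSet K n ↔ L ∈ admSet K n := by
  rw [mem_admSet, mem_admSet]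
  have hsum : ∑ v ∈ (L.act π).X, Nat.log 2 (((L.act π).lam v : ℕ) + 1) = ∑ v ∈ L.X, Nat.log 2 ((L.lam v : ℕ) + 1) := by
    rw [act_X, Finset.sum_map]
    simp
  rw [hsum]
  simp only [mem_act_X, act_lam]
  refine and_congr ⟨fun h v hv => ?_, fun h v hv => h _ hv⟩ Iff.rfl
  have := h (π v) (by rwa [symm_apply_apply])
  rwa [symm_apply_apply] at this

/-! ### The syntactic measure and the two label formers -/

/-- The SYNTACTIC MEASURE `|U|(n+1) + (n - |X|)`: a group reads only groups of smaller measure. -/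
def M (L : RawLab n) : ℕ := L.U.card * (n + 1) + (n - L.X.card)

/-- The measure is invariant under relabelling. -/
@[simp] theorem M_act (π : Perm (Fin n)) (L : RawLab n) : (L.act π).M = L.M := by simp [M]

/-- The measure is at most `n(n+1) + n`. -/
theorem M_le (L : RawLab n) : L.M ≤ n * (n + 1) + n := by
  unfold M
  have h1 : L.U.card ≤ n := (card_le_univ _).trans_eq (Fintype.card_fin n)
  have h2 : n - L.X.card ≤ n := Nat.sub_le _ _
  nlinarith

/-- The CANDIDATE label for individualising `x` with recorded height `h`: `(U, X ∪ {x}, λ[x ↦ h])`. -/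
def cand (L : RawLab n) (x : Fin n) (h : Fin (n + 1)) : RawLab n := ⟨L.U, insert x L.X, Function.update L.lam x h⟩

/-- The PART label with vertex set `U'`: `(U', X, λ)`. -/
def part (L : RawLab n) (U' : Finset (Fin n)) : RawLab n := ⟨U', L.X, L.lam⟩

/-- `cand_U`: bookkeeping/simp lemma (cand U). -/
@[simp] theorem cand_U (L : RawLab n) (x : Fin n) (h : Fin (n + 1)) : (L.cand x h).U = L.U := rfl
/-- `cand_X`: bookkeeping/simp lemma (cand X). -/
@[simp] theorem cand_X (L : RawLab n) (x : Fin n) (h : Fin (n + 1)) : (L.cand x h).X = insert x L.X := rfl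
/-- `cand_lam`: bookkeeping/simp lemma (cand lam). -/
@[simp] theorem cand_lam (L : RawLab n) (x : Fin n) (h : Fin (n + 1)) : (L.cand x h).lam = Function.update L.lam x h := rfl
/-- `part_U`: bookkeeping/simp lemma (part U). -/
@[simp] theorem part_U (L : RawLab n) (U' : Finset (Fin n)) : (L.part U').U = U' := rfl
/-- `part_X`: bookkeeping/simp lemma (part X). -/
@[simp] theorem part_X (L : RawLab n) (U' : Finset (Fin n)) : (L.part U').X = L.X := rfl
/-- `part_lam`: bookkeeping/simp lemma (part lam). -/
@[simp] theorem part_lam (L : RawLab n) (U' : Finset (Fin n)) : (L.part U').lam = L.lam := rfl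

/-- Reading a candidate with a fresh vertex: the measure drops. -/
theorem M_cand_lt (L : RawLab n) {x : Fin n} (hx : x ∉ L.X) (h : Fin (n + 1)) : (L.cand x h).M < L.M := by
  unfold M
  have h1 : (insert x L.X).card = L.X.card + 1 := card_insert_of_notMem hx
  have h2 : (insert x L.X).card ≤ n := (card_le_univ _).trans_eq (Fintype.card_fin n)
  simp only [cand_U, cand_X, h1] at h2 ⊢
  omega

/-- Reading a proper part: the measure drops. -/
theorem M_part_lt (L : RawLab n) {U' : Finset (Fin n)} (hU : U' ⊂ L.U) : (L.part U').M < L.M := by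
  unfold M
  have h1 : U'.card < L.U.card := card_lt_card hU
  have h2 : n - L.X.card ≤ n := Nat.sub_le _ _
  simp only [part_U, part_X]
  nlinarith

/-- Parts of admissible labels are admissible (same `X`, same heights). -/
theorem part_mem_admSet {K : ℕ} {L : RawLab n} (h : L ∈ admSet K n) (U' : Finset (Fin n)) : L.part U' ∈ admSet K n := by
  rw [mem_admSet] at h ⊢; exact h

/-- Relabelling commutes with `cand`. -/
theorem act_cand (π : Perm (Fin n)) (L : RawLab n) (x : Fin n) (h : Fin (n + 1)) :
    (L.cand x h).act π = (L.act π).cand (π x) h := by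
  simp only [cand, act, RawLab.mk.injEq, Finset.map_insert, Equiv.toEmbedding_apply, true_and]
  funext v
  by_cases hv : v = π x
  · subst hv; simp
  · have : π.symm v ≠ x := fun e => hv (by rw [← e, apply_symm_apply])
    simp [hv, this]

/-- Relabelling commutes with `part`. -/
theorem act_part (π : Perm (Fin n)) (L : RawLab n) (U' : Finset (Fin n)) :
    (L.part U').act π = (L.act π).part (U'.map π.toEmbedding) := rfl

end RawLab

/-- **The admissible labels** at disorder constant `K`: the index set of the gate groups. -/
abbrev Lab (K n : ℕ) : Type := {L : RawLab n // L ∈ RawLab.admSet K n}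

namespace Lab

variable {K n : ℕ}

/-- There are as many admissible labels as members of `admSet`. -/
theorem card_eq : Fintype.card (Lab K n) = (RawLab.admSet K n).card := Fintype.card_coe _

/-- The action of window permutations on admissible labels. -/
def act (π : Perm (Fin n)) (L : Lab K n) : Lab K n := ⟨L.1.act π, RawLab.act_mem_admSet_iff.2 L.2⟩

/-- `act_val`: bookkeeping/simp lemma (act val). -/
@[simp] theorem act_val (π : Perm (Fin n)) (L : Lab K n) : (L.act π).1 = L.1.act π := rfl

/-- `act_one`: bookkeeping/simp lemma (act one). -/
@[simp] theorem act_one (L : Lab K n) : L.act 1 = L := Subtype.ext (RawLab.act_one L.1)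

/-- `act_mul`: bookkeeping/simp lemma (act mul). -/
theorem act_mul (π τ : Perm (Fin n)) (L : Lab K n) : L.act (π * τ) = (L.act τ).act π := Subtype.ext (RawLab.act_mul π τ L.1)

/-- `act_inv_act`: bookkeeping/simp lemma (act inv act). -/
@[simp] theorem act_inv_act (π : Perm (Fin n)) (L : Lab K n) : (L.act π).act π⁻¹ = L := Subtype.ext (RawLab.act_inv_act π L.1)

/-- `act_act_inv`: bookkeeping/simp lemma (act act inv). -/
@[simp] theorem act_act_inv (π : Perm (Fin n)) (L : Lab K n) : (L.act π⁻¹).act π = L := Subtype.ext (RawLab.act_act_inv π L.1)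

/-- The action as a permutation of the labels. -/
def actEquiv (π : Perm (Fin n)) : Perm (Lab K n) where
  toFun := act π
  invFun := act π⁻¹
  left_inv := act_inv_act π
  right_inv := act_act_inv π

/-- `actEquiv_apply`: bookkeeping/simp lemma (actEquiv apply). -/
@[simp] theorem actEquiv_apply (π : Perm (Fin n)) (L : Lab K n) : actEquiv π L = L.act π := rfl

/-- The ROOT label `(univ, ∅, 0)` (admissible for every `K`). -/
def root (K n : ℕ) : Lab K n :=
  ⟨⟨univ, ∅, fun _ => 0⟩, RawLab.mem_admSet.2 ⟨fun _ _ => rfl, by simp⟩⟩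

/-- The root label is fixed by every relabelling. -/
@[simp] theorem act_root (π : Perm (Fin n)) : (root K n).act π = root K n := by
  apply Subtype.ext
  simp [root, RawLab.act]
  rfl

end Lab

end WCan

end Summit.PneNP.PneNP.Theorems
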